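import Summits.ResolutionOfSingularities.ResolutionOfSingularities.Theorems.WallFrames8
import Summits.ResolutionOfSingularities.ResolutionOfSingularities.Theorems.NearCutCompanion3
import Summits.ResolutionOfSingularities.ResolutionOfSingularities.Theorems.NearCutWalls2
import Summits.ResolutionOfSingularities.ResolutionOfSingularities.Theorems.ProximityCutArcLaw
import Summits.ResolutionOfSingularities.ResolutionOfSingularities.Theorems.MaxContactCutBoundaryLedger
import Summits.ResolutionOfSingularities.ResolutionOfSingularities.Theorems.MaxContactCutWallCut
import Summits.ResolutionOfSingularities.ResolutionOfSingularities.Theorems.PlanarGhostDescent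
import Literature.AlgebraicGeometry.Resolution.PointBlowupIFPGiraud
import Literature.AlgebraicGeometry.Resolution.AdicNoetherian
import HarnessLib

/-!
# WallFrames (9/17) — Kollár's wall descent in a polynomial frame; sections: Transversal (cont.), Moves

Verbatim slice of the farm-checked monolith `WallFrames.lean` of cell `decomp-res`, seat `decomp-res-lens-5`, g35
(sha256 7405a21d81d102a4…, monolith lines 2142–2408); one namespace `Summit.ResolutionOfSingularities.ResolutionOfSingularities.Theorems.WallFrames` across the
slices, imports chained.  The monolith's module docstring (laws W1–W7, mechanism, novelty, honest placement) is
reproduced in slice 1; the main theorem `balancedWallPort_holds : WallCut.BalancedWallPort` (hypothesis-free) and the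
host-route corollary `ecBalancedWallPort_holds` (aside item 27368 of route MaxContactCut) are in slice 16/17.
-/

open MvPolynomial Finset
open scoped BigOperators
open Literature.AlgebraicGeometry.Resolution
open Literature.AlgebraicGeometry.Resolution.Hauser2010
open Literature.AlgebraicGeometry.Resolution.PointBlowup
open Literature.AlgebraicGeometry.Resolution.HauserPerlega2024

namespace Summit.ResolutionOfSingularities.ResolutionOfSingularities.Theorems.WallFrames

variable {σ : Type*} [Fintype σ] [DecidableEq σ] {K : Type*} [Field K]

section Transversal

omit [Fintype σ] [DecidableEq σ] in
/-- An exponent of degree `1` is a unit vector. [folklore] -/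
theorem exists_eq_single_of_degree_eq_one {β : σ →₀ ℕ} (h : β.degree = 1) : ∃ i, β = Finsupp.single i 1 := by
  have hne : β ≠ 0 := by
    rintro rfl
    rw [map_zero] at h
    exact zero_ne_one h
  obtain ⟨i, hi⟩ := Finsupp.ne_iff.mp hne
  rw [Finsupp.zero_apply] at hi
  refine ⟨i, ?_⟩
  have hle : Finsupp.single i (β i) ≤ β := Finsupp.single_le_iff.mpr le_rfl
  obtain ⟨γ, hγ⟩ : ∃ γ, β = Finsupp.single i (β i) + γ :=
    ⟨β - Finsupp.single i (β i), (add_tsub_cancel_of_le hle).symm⟩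
  have hdeg : β.degree = β i + γ.degree := by
    conv_lhs => rw [hγ]
    rw [map_add, Finsupp.degree_single]
  have hβi : β i = 1 := by omega
  have hγ0 : γ = 0 := (Finsupp.degree_eq_zero_iff γ).mp (by omega)
  rw [hγ, hγ0, add_zero, hβi]

omit [Fintype σ] in
/-- A linear form evaluated at the unit point `e_o` is its `y_o`-coefficient. [folklore] -/
theorem eval_pi_single_of_isHomogeneous_one {ℓ : MvPolynomial σ K} (hℓ : ℓ.IsHomogeneous 1) (o : σ) :
    eval (Pi.single o (1 : K)) ℓ = coeff (Finsupp.single o 1) ℓ := by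
  classical
  rw [MvPolynomial.eval_eq]
  rw [Finset.sum_eq_single (Finsupp.single o 1)]
  · rw [Finsupp.support_single o one_ne_zero, Finset.prod_singleton, Finsupp.single_eq_same, pow_one,
      Pi.single_eq_same, mul_one]
  · intro d hd hne
    have hdeg : d.degree = 1 := by
      by_contra h
      exact (mem_support_iff.mp hd) (hℓ.coeff_eq_zero h)
    obtain ⟨i, rfl⟩ := exists_eq_single_of_degree_eq_one hdeg
    have hio : i ≠ o := fun h => hne (by rw [h])
    rw [Finsupp.support_single i one_ne_zero, Finset.prod_singleton, Finsupp.single_eq_same, pow_one,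
      Pi.single_apply, if_neg hio, mul_zero]
  · intro h
    rw [notMem_support_iff.mp h, zero_mul]

omit [Fintype σ] in
/-- A linear form is the sum of its coefficient multiples of the variables. [folklore] -/
theorem eq_sum_of_isHomogeneous_one [Fintype σ] {ℓ : MvPolynomial σ K} (hℓ : ℓ.IsHomogeneous 1) :
    ℓ = ∑ i, C (coeff (Finsupp.single i 1) ℓ) * X i := by
  classical
  ext d
  rw [coeff_sum]
  simp only [coeff_C_mul, coeff_X, mul_ite, mul_one, mul_zero]
  by_cases hd : d.degree = 1
  · obtain ⟨i, rfl⟩ := exists_eq_single_of_degree_eq_one hd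
    rw [Finset.sum_eq_single i]
    · rw [if_pos rfl]
    · intro b _ hb
      rw [if_neg (fun h => hb (Finsupp.single_left_injective one_ne_zero h))]
    · intro h; exact absurd (Finset.mem_univ i) h
  · rw [hℓ.coeff_eq_zero hd, eq_comm]
    refine Finset.sum_eq_zero fun i _ => ?_
    rw [if_neg]
    intro h; apply hd; rw [← h, Finsupp.degree_single]

omit [Fintype σ] in
/-- **NEARNESS READING.**  A linear form evaluated at a point: `ℓ(x) = Σ_i α_i x_i`; with
`constantCoeff_translate_chartTransform` this turns `ord G_{t+1} ≥ 1` into the centre equation `ℓ_t(b̂) = 0`. [folklore] -/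
theorem eval_of_isHomogeneous_one [Fintype σ] {ℓ : MvPolynomial σ K} (hℓ : ℓ.IsHomogeneous 1) (x : σ → K) :
    eval x ℓ = ∑ i, coeff (Finsupp.single i 1) ℓ * x i := by
  conv_lhs => rw [eq_sum_of_isHomogeneous_one hℓ, map_sum]
  simp only [map_mul, eval_C, eval_X]

omit [Fintype σ] in
/-- The chart transform fixes an axis form off the chart variable: `cT_s^j (c·y_k^s) = c·y_k^s` (`j ≠ k`). [folklore] -/
theorem chartTransform_C_mul_X_pow {j k : σ} (hjk : j ≠ k) (s : ℕ) (c : K) :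
    chartTransform s j (C c * X k ^ s) = C c * X k ^ s := by
  have hexp : chartExponent s j (Finsupp.single k s) = Finsupp.single k s := by
    unfold chartExponent
    rw [Finsupp.degree_single, Nat.sub_self]
    ext i
    rw [Finsupp.coe_update, Function.update_apply]
    by_cases h : i = j
    · subst h; rw [if_pos rfl, Finsupp.single_apply, if_neg (Ne.symm hjk)]
    · rw [if_neg h]
  rw [C_mul_X_pow_eq_monomial, chartTransform_monomial, hexp]

omit [Fintype σ] in
/-- **AXIS PROPAGATION.**  If `in_s(G) = c·y_k^s` (the directrix is the kept wall's plane) then after ANY move in a chart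
`j ≠ k` with `b_j = b_k = 0` the new companion is `≡ c·y_k^s (mod y_j)`. [new] -/
theorem translate_chartTransform_sub_mem_span {j k : σ} (hjk : j ≠ k) {b : σ → K} (hbj : b j = 0) (hbk : b k = 0)
    {s : ℕ} {c : K} {G : MvPolynomial σ K} (hs : (s : ℕ∞) ≤ ordZero G)
    (hG : homogeneousComponent s G = C c * X k ^ s) :
    PointBlowup.translate b (chartTransform s j G) - C c * X k ^ s ∈ Ideal.span {(X j : MvPolynomial σ K)} := by
  set R : MvPolynomial σ K := G - homogeneousComponent s G with hRdef
  have hR : ((s + 1 : ℕ) : ℕ∞) ≤ ordZero R := Hauser2010.succ_le_ordZero_sub_homogeneousComponent hs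
  have hsplit : G = homogeneousComponent s G + R := by rw [hRdef]; ring
  have hrest : chartTransform s j R = X j ^ (s + 1 - s) * chartTransform (s + 1) j R :=
    chartTransform_eq_X_pow_mul_chartTransform j (Nat.le_succ s) hR
  rw [Nat.add_sub_cancel_left, pow_one] at hrest
  have hform : PointBlowup.translate b (C c * X k ^ s) = C c * X k ^ s := by
    unfold PointBlowup.translate
    rw [map_mul, map_pow, aeval_C, aeval_X, hbk, C_0, add_zero, algebraMap_eq]
  have hXj : PointBlowup.translate b (X j * chartTransform (s + 1) j R) =
      X j * PointBlowup.translate b (chartTransform (s + 1) j R) := by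
    unfold PointBlowup.translate
    rw [map_mul, aeval_X, hbj, C_0, add_zero]
  have hmain : PointBlowup.translate b (chartTransform s j G) =
      C c * X k ^ s + X j * PointBlowup.translate b (chartTransform (s + 1) j R) := by
    conv_lhs => rw [hsplit, chartTransform_add, HauserPerlega2024.translate_add, hrest, hXj, hG,
      chartTransform_C_mul_X_pow hjk, hform]
  refine Ideal.mem_span_singleton'.mpr ⟨PointBlowup.translate b (chartTransform (s + 1) j R), ?_⟩
  rw [hmain]
  ring

omit [Fintype σ] [DecidableEq σ] in
/-- Reading the congruence on the degree-`s` layer: `in_s(G') = c·y_k^s + y_j·L`. [new] -/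
theorem homogeneousComponent_eq_add_of_sub_mem_span {j k : σ} {s : ℕ} (hs : 1 ≤ s) {c : K}
    {G' : MvPolynomial σ K} (h : G' - C c * X k ^ s ∈ Ideal.span {(X j : MvPolynomial σ K)}) :
    ∃ L : MvPolynomial σ K, homogeneousComponent s G' = C c * X k ^ s + X j * L := by
  obtain ⟨L₀, hL₀⟩ := Ideal.mem_span_singleton'.mp h
  refine ⟨homogeneousComponent (s - 1) L₀, ?_⟩
  have hG' : G' = C c * X k ^ s + L₀ * X j := by rw [hL₀]; ring
  have hform : (C c * X k ^ s : MvPolynomial σ K).IsHomogeneous s := by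
    rw [C_mul_X_pow_eq_monomial]
    exact isHomogeneous_monomial _ (by rw [Finsupp.degree_single])
  rw [hG', map_add, homogeneousComponent_eq_self hform,
    homogeneousComponent_mul_of_isHomogeneous L₀ (X j) s (isHomogeneous_X K j), if_pos hs]
  ring

omit [Fintype σ] in
/-- **TRANSVERSALITY READING.**  If `c'·ℓ^s = c·y_k^s + y_j·L` with `c, c' ≠ 0`, `s ≠ 0`, `ℓ` linear, then `ℓ` has no
component on any third variable and a non-zero `y_k`-component: the directrix stays in the wall span and the kept wall
is kept again. [new] -/
theorem transversal_of_congr {j k : σ} (hjk : j ≠ k) {s : ℕ} (hs : s ≠ 0) {c c' : K} (hc : c ≠ 0) (hc' : c' ≠ 0)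
    {ℓ L : MvPolynomial σ K} (hℓ : ℓ.IsHomogeneous 1) (h : C c' * ℓ ^ s = C c * X k ^ s + X j * L) :
    (∀ o, o ≠ j → o ≠ k → coeff (Finsupp.single o 1) ℓ = 0) ∧ coeff (Finsupp.single k 1) ℓ ≠ 0 := by
  classical
  have heval : ∀ o, o ≠ j →
      c' * coeff (Finsupp.single o 1) ℓ ^ s = c * (if k = o then 1 else 0) ^ s := by
    intro o hoj
    have h1 := congrArg (eval (Pi.single o (1 : K))) h
    rw [map_mul, map_pow, eval_C, eval_pi_single_of_isHomogeneous_one hℓ, map_add, map_mul, map_mul, map_pow,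
      eval_C, eval_X, eval_X, Pi.single_apply, Pi.single_apply, if_neg (Ne.symm (Ne.symm hoj) ∘ Eq.symm)] at h1
    rw [h1]; ring
  refine ⟨fun o hoj hok => ?_, fun h0 => ?_⟩
  · have h1 := heval o hoj
    rw [if_neg (Ne.symm hok), zero_pow hs, mul_zero] at h1
    exact pow_eq_zero_iff hs |>.mp ((mul_eq_zero.mp h1).resolve_left hc')
  · have h1 := heval k (Ne.symm hjk)
    rw [h0, if_pos rfl, one_pow, mul_one, zero_pow hs, mul_zero] at h1
    exact hc h1.symm

/-! ### Apolarity and the LINEAGE TANGENT LAW: every element of the Hasse lineage ideal `hasseSpan (s−1) G`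
has linear part proportional to the directrix `ℓ` (`in_s G = c·ℓ^s`).  So the transported frame hypersurface
`h_t` is tangent to the directrix plane at every stage, and its `y_v`-coefficient is `≠ 0` exactly when `α_v ≠ 0`. -/

omit [Fintype σ] [DecidableEq σ] in
/-- Taylor of a linear form: `ℓ(x + u) = ℓ(x) + ℓ(u)`. [folklore] -/
theorem taylor_of_isHomogeneous_one {ℓ : MvPolynomial σ K} (hℓ : ℓ.IsHomogeneous 1) :
    taylor K ℓ = C ℓ + MvPolynomial.map C ℓ := by
  classical
  conv_lhs => rw [ℓ.as_sum]
  conv_rhs => rw [ℓ.as_sum]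
  rw [map_sum, map_sum, map_sum, ← Finset.sum_add_distrib]
  refine Finset.sum_congr rfl fun e he => ?_
  obtain ⟨i, rfl⟩ := exists_eq_single_of_degree_eq_one (degree_eq_of_mem_support hℓ he)
  rw [← C_mul_X_eq_monomial, map_mul, taylor_C, taylor_X, map_mul, map_mul, map_C, map_X]
  ring

omit [Fintype σ] [DecidableEq σ] in
/-- **APOLARITY.**  `D^{(d)}(c·ℓ^s) = (s·c·coeff_d(ℓ^{s−1}))·ℓ` for `|d| = s − 1` and a linear form `ℓ`: the
polars of order `s − 1` of a pure power are multiples of its root. [folklore] -/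
theorem hasseDeriv_C_mul_pow_of_isHomogeneous_one {ℓ : MvPolynomial σ K} (hℓ : ℓ.IsHomogeneous 1) (c : K)
    {s : ℕ} (hs : 1 ≤ s) {d : σ →₀ ℕ} (hd : d.degree = s - 1) :
    hasseDeriv K d (C c * ℓ ^ s) = C ((s : K) * c * coeff d (ℓ ^ (s - 1))) * ℓ := by
  classical
  rw [hasseDeriv_apply, map_mul, taylor_C, map_pow, taylor_of_isHomogeneous_one hℓ, add_pow, Finset.mul_sum,
    coeff_sum]
  have hterm : ∀ k ∈ Finset.range (s + 1),
      coeff d (C (C c) * ((C ℓ) ^ k * (MvPolynomial.map C ℓ) ^ (s - k) * (s.choose k : MvPolynomial σ (MvPolynomial σ K)))) =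
        C c * ℓ ^ k * (s.choose k : MvPolynomial σ K) * C (coeff d (ℓ ^ (s - k))) := by
    intro k hk
    have hre : C (C c) * ((C ℓ) ^ k * (MvPolynomial.map C ℓ) ^ (s - k) *
        (s.choose k : MvPolynomial σ (MvPolynomial σ K))) =
        C (C c * ℓ ^ k * (s.choose k : MvPolynomial σ K)) * (MvPolynomial.map C ℓ) ^ (s - k) := by
      rw [map_mul, map_mul, map_pow, map_natCast]; ring
    rw [hre, coeff_C_mul, ← map_pow, coeff_map]
  rw [Finset.sum_congr rfl hterm, Finset.sum_eq_single 1]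
  · rw [pow_one, Nat.choose_one_right, map_mul, map_mul, map_natCast]; ring
  · intro k hk hk1
    have hks : k ≤ s := by have := Finset.mem_range.mp hk; omega
    have hzero : coeff d (ℓ ^ (s - k)) = 0 := by
      refine (hℓ.pow (s - k)).coeff_eq_zero ?_
      rw [hd]; omega
    rw [hzero, map_zero, mul_zero]
  · intro h; exact absurd (Finset.mem_range.mpr (by omega)) h

omit [Fintype σ] in
/-- Linear coefficients of a product with a factor vanishing at the origin. [folklore] -/
theorem coeff_single_one_mul {i : σ} (a x : MvPolynomial σ K) (hx : constantCoeff x = 0) :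
    coeff (Finsupp.single i 1) (a * x) = constantCoeff a * coeff (Finsupp.single i 1) x := by
  classical
  rw [coeff_mul, Finset.sum_eq_single ((0 : σ →₀ ℕ), Finsupp.single i 1)]
  · rfl
  · rintro ⟨p, q⟩ hpq hne
    have hsum : p + q = Finsupp.single i 1 := Finset.HasAntidiagonal.mem_antidiagonal.mp hpq
    by_cases hp : p = 0
    · exfalso; apply hne
      subst hp; rw [zero_add] at hsum; rw [hsum]
    · have hq : q = 0 := by
        have hdeg : p.degree + q.degree = 1 := by rw [← map_add, hsum, Finsupp.degree_single]
        have hp1 : 1 ≤ p.degree := Nat.one_le_iff_ne_zero.mpr fun h => hp ((Finsupp.degree_eq_zero_iff p).mp h)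
        exact (Finsupp.degree_eq_zero_iff q).mp (by omega)
      rw [hq]
      show coeff p a * constantCoeff x = 0
      rw [hx, mul_zero]
  · intro h; exact absurd (Finset.HasAntidiagonal.mem_antidiagonal.mpr (zero_add _)) h

omit [Fintype σ] in
/-- **LINEAGE TANGENT LAW.**  For `ord G ≥ s ≥ 1`, `in_s G = c·ℓ^s`, every `h` in the lineage ideal
`hasseSpan (s−1) G` vanishes at the origin and has linear part `μ·ℓ`. [new] -/
theorem lineage_tangent {s : ℕ} (hs : 1 ≤ s) {G ℓ : MvPolynomial σ K} {c : K} (hℓ : ℓ.IsHomogeneous 1)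
    (hG : (s : ℕ∞) ≤ ordZero G) (hin : homogeneousComponent s G = C c * ℓ ^ s)
    {h : MvPolynomial σ K} (hh : h ∈ hasseSpan (s - 1) G) :
    constantCoeff h = 0 ∧ ∃ μ : K, ∀ i, coeff (Finsupp.single i 1) h = μ * coeff (Finsupp.single i 1) ℓ := by
  classical
  unfold hasseSpan at hh
  refine Submodule.span_induction ?_ ?_ ?_ ?_ hh
  · rintro x ⟨M, hM, rfl⟩
    have hM' : M.degree ≤ s - 1 := hM
    beta_reduce
    refine ⟨?_, ?_⟩
    · rw [constantCoeff_hasseDeriv]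
      exact coeff_eq_zero_of_degree_lt_ordZero (lt_of_lt_of_le (by exact_mod_cast (show M.degree < s by omega)) hG)
    · by_cases hMd : M.degree = s - 1
      · refine ⟨(s : K) * c * coeff M (ℓ ^ (s - 1)), fun i => ?_⟩
        set R : MvPolynomial σ K := G - homogeneousComponent s G with hRdef
        have hR : ((s + 1 : ℕ) : ℕ∞) ≤ ordZero R := Hauser2010.succ_le_ordZero_sub_homogeneousComponent hG
        have hsplit : G = homogeneousComponent s G + R := by rw [hRdef]; ring
        have hDR : ((s + 1 - M.degree : ℕ) : ℕ∞) ≤ ordZero (hasseDeriv K M R) :=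
          natCast_sub_le_ordZero_hasseDeriv M hR
        have hlinR : coeff (Finsupp.single i 1) (hasseDeriv K M R) = 0 :=
          coeff_eq_zero_of_degree_lt_ordZero (lt_of_lt_of_le
            (by rw [Finsupp.degree_single]; exact_mod_cast (show 1 < s + 1 - M.degree by omega)) hDR)
        rw [hsplit, map_add, coeff_add, hlinR, add_zero, hin, hasseDeriv_C_mul_pow_of_isHomogeneous_one hℓ c hs hMd,
          coeff_C_mul]
      · refine ⟨0, fun i => ?_⟩
        have hD : ((s - M.degree : ℕ) : ℕ∞) ≤ ordZero (hasseDeriv K M G) := natCast_sub_le_ordZero_hasseDeriv M hG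
        rw [zero_mul]
        exact coeff_eq_zero_of_degree_lt_ordZero (lt_of_lt_of_le
          (by rw [Finsupp.degree_single]; exact_mod_cast (show 1 < s - M.degree by omega)) hD)
  · exact ⟨by simp, 0, fun i => by simp⟩
  · rintro x y - - ⟨hx0, μ, hμ⟩ ⟨hy0, ν, hν⟩
    exact ⟨by rw [map_add, hx0, hy0, add_zero], μ + ν, fun i => by rw [coeff_add, hμ, hν]; ring⟩
  · rintro a x - ⟨hx0, μ, hμ⟩
    refine ⟨by rw [smul_eq_mul, map_mul, hx0, mul_zero], constantCoeff a * μ, fun i => ?_⟩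
    rw [smul_eq_mul, coeff_single_one_mul a x hx0, hμ, mul_assoc]

end Transversal

/-! ## §15 The anatomy of a δ-balanced move (walk level; the dictionary walk ↔ frame of NEXT-g36 §1)

At every move of a δ-balanced tail there are: the chart `j_t`, the KEPT wall `k_t` (`r_t k = r_{t+1} k = δ`, `b_t k = 0`),
and the third index `o_t` with `r_{t+1} o = 0`; the centre is supported on `o_t` only; and EITHER the chart is an old wall
(LOST-WALL MOVE: `r_t j = δ`, `o_t` is the free letter, `r_t o = 0`) OR the chart is the free letter (FREE-CHART MOVE:
`r_t j = 0`, `o_t` is the lost wall, `r_t o = δ`, and then the centre is NON-ZERO: `b_t o ≠ 0`, since a zero translation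
would keep the wall).  `StaysOnNewest W t` then forces move `t+1` to lose `k_t`, whence the letter switch. -/

section Moves

variable {L : Type} [Field L] [DecidableEq L]

end Moves

end Summit.ResolutionOfSingularities.ResolutionOfSingularities.Theorems.WallFrames
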